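import Literature.AlgebraicGeometry.HodgeTheory.FermatSurfaceLines
import Literature.AlgebraicGeometry.HodgeTheory.ComplexOrientationFamily
import Literature.AlgebraicGeometry.HodgeTheory.FermatDiagonalAction
import HarnessLib

/-!
# Slope pairs, translations and plane families of the lines of the Fermat surface (definitions)

Family `hodge`, layer `Literature/AlgebraicGeometry/HodgeTheory`. DEFINITION FILE (small definitions and
their unfolding lemmas; no named fact) for the sequels of `FermatSurfaceLines` (the lines
`L(u, u') : x₀ = u x₁, x₂ = u' x₃`, `uᵐ = u'ᵐ = -1`, of `X = X²ₘ ⊂ ℙ³_ℂ`; Shioda, Math. Ann. 245 (1979) §1;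
Hartshorne V Ex. 4.16 for `m = 3`), which prove the `G`-equivariance of the line classes, the structure
of the plane sections and Aoki's Thm. 1-1 for `r = 1` (`Shioda1979_lines_represent`):

* `FermatSurface.pair u u'` — the slope pair `w = (u, u')`; `FermatSurface.translate a w` — the slopes
  `(u a₁/a₀, u' a₃/a₂)` of `a⁻¹ · L(u, u')` for a diagonal symmetry `a ∈ μₘ⁴` (`[x] ↦ [a • x]`);
  `FermatSurface.lineTwist a` — the reparametrisation `[y₀ : y₁] ↦ [a₁⁻¹ y₀ : a₃⁻¹ y₁]` of `ℙ¹`;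
* `FermatSurface.negRoots m` — the finite set `{u | uᵐ = -1}` of slopes (`exists_eq_negRoot_mul`:
  `aᵐ + bᵐ = 0 ⟹ a = u b`), `FermatSurface.rootsToNegRoots` (`η ↦ u' η : μₘ ≃ negRoots m`) and the
  reducible shorthand `FermatSurface.lineCls m u u'` for `cl L(u, u')` with the complex orientations;
* `FermatSurface.planeLine q v u` — the slopes of the lines of the plane section `x_{2q} = v x_{2q+1}`
  (slope `v` at the pair `q`, `u` at the other pair), `FermatSurface.apexVec q v` — the homogeneous
  coordinates of their common point (`[v : 1 : 0 : 0]`, resp. `[0 : 0 : v : 1]`);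
* `FermatSurface.planeSubst q v`, `FermatSurface.planeEmb m q v : X ↪ ℙ³ ↪ ℙ⁴`,
  `[x] ↦ [x_{2q} - v x_{2q+1} : x₀ : ⋯ : x₃]` — the re-embedding moving the plane to `{y₀ = 0}` (as in
  `FermatCubicSurfaceLineClasses` for `m = 3`).

## References

* [Shioda1979HodgeFermat] T. Shioda, The Hodge conjecture for Fermat varieties, Math. Ann. 245 (1979), §1.
* [Hartshorne1977] R. Hartshorne, Algebraic Geometry (1977), V Ex. 4.16, II Example 7.1.1, II Ex. 3.12.
-/

noncomputable section

open scoped LinearAlgebra.Projectivization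
open CategoryTheory AlgebraicGeometry MvPolynomial
open Literature.AlgebraicGeometry.Motives Literature.AlgebraicTopology.SingularHomology
open Literature.NumberTheory.Transcendental

namespace Literature.AlgebraicGeometry.HodgeTheory

namespace FermatSurface

variable {m : ℕ}

/-! ### The action of `μₘ⁴` on the slopes -/

/-- **The slopes `(u a₁/a₀, u' a₃/a₂)` of the line `a⁻¹ · L(u, u')`** (`a⁻¹ • (u y₀, y₀, u' y₁, y₁)` is
the point of parameter `(a₁⁻¹ y₀, a₃⁻¹ y₁)` on that line). [cite: Shioda1979HodgeFermat, §1] -/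
def translate (a : Fin (2 * 1 + 2) → ℂˣ) (w : Fin 2 → ℂ) : Fin 2 → ℂ :=
  ![w 0 * ((a 1 / a 0 : ℂˣ) : ℂ), w 1 * ((a 3 / a 2 : ℂˣ) : ℂ)]

/-- `translate a w 0 = u a₁/a₀`. [folklore] -/
@[simp] theorem translate_zero (a : Fin (2 * 1 + 2) → ℂˣ) (w : Fin 2 → ℂ) :
    translate a w 0 = w 0 * ((a 1 / a 0 : ℂˣ) : ℂ) := rfl

/-- `translate a w 1 = u' a₃/a₂`. [folklore] -/
@[simp] theorem translate_one (a : Fin (2 * 1 + 2) → ℂˣ) (w : Fin 2 → ℂ) :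
    translate a w 1 = w 1 * ((a 3 / a 2 : ℂˣ) : ℂ) := rfl

/-- A quotient of `m`-th roots of unity is an `m`-th root of unity (in `ℂ`). [folklore] -/
theorem coe_div_pow_eq_one {a : Fin (2 * 1 + 2) → ℂˣ} (ha : a ∈ fermatGroup (2 * 1) m)
    (i j : Fin (2 * 1 + 2)) : ((a i / a j : ℂˣ) : ℂ) ^ m = 1 := by
  have h := mem_fermatGroup_iff.mp ha
  rw [← Units.val_pow_eq_pow_val, div_pow, h i, h j, div_one, Units.val_one]

/-- Translated slopes are again roots of `-1`. [folklore] -/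
theorem translate_pow {a : Fin (2 * 1 + 2) → ℂˣ} (ha : a ∈ fermatGroup (2 * 1) m) {w : Fin 2 → ℂ}
    (hw : ∀ q, w q ^ m = -1) : ∀ q, translate a w q ^ m = -1 := by
  refine Fin.forall_fin_two.mpr ⟨?_, ?_⟩
  · rw [translate_zero, mul_pow, hw 0, coe_div_pow_eq_one ha, mul_one]
  · rw [translate_one, mul_pow, hw 1, coe_div_pow_eq_one ha, mul_one]

/-! ### Slope pairs -/

/-- The slope pair `(u, u')` of the line `L(u, u') : x₀ = u x₁, x₂ = u' x₃`. [cite: Shioda1979HodgeFermat, §1] -/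
def pair (u u' : ℂ) : Fin 2 → ℂ :=
  ![u, u']

/-- `pair u u' 0 = u`. [folklore] -/
@[simp] theorem pair_zero (u u' : ℂ) : pair u u' 0 = u := rfl

/-- `pair u u' 1 = u'`. [folklore] -/
@[simp] theorem pair_one (u u' : ℂ) : pair u u' 1 = u' := rfl

/-- Roots of `-1` give admissible slope pairs. [folklore] -/
theorem pair_pow {u u' : ℂ} (hu : u ^ m = -1) (hu' : u' ^ m = -1) : ∀ q, pair u u' q ^ m = -1 :=
  Fin.forall_fin_two.mpr ⟨hu, hu'⟩

/-- `translate a (u, u') = (u a₁/a₀, u' a₃/a₂)` (`rfl`). [folklore] -/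
theorem translate_pair_eq (a : Fin (2 * 1 + 2) → ℂˣ) (u u' : ℂ) :
    translate a (pair u u') = pair (u * ((a 1 / a 0 : ℂˣ) : ℂ)) (u' * ((a 3 / a 2 : ℂˣ) : ℂ)) := rfl

/-- The class of a line only depends on its slope pair (not on the proof that the slopes are roots
of `-1`). [folklore] -/
theorem lineClass_congr (μ : OrientationFamily) (hm : 1 ≤ m) {w w' : Fin 2 → ℂ} (h : w = w')
    (hw : ∀ q, w q ^ m = -1) (hw' : ∀ q, w' q ^ m = -1) :
    lineClass μ m w hw hm = lineClass μ m w' hw' hm := by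
  subst h
  rfl

/-- `translate (1, ξ, 1, η) (u, u') = (u ξ, u' η)` for roots of unity `ξ, η`. [folklore] -/
theorem translate_pair (ξ η : rootsOfUnity m ℂ) (u u' : ℂ) :
    translate (fermatGroupEquiv m ![1, ξ, 1, η] : fermatGroup (2 * 1) m) (pair u u') =
      pair (u * ((ξ : ℂˣ) : ℂ)) (u' * ((η : ℂˣ) : ℂ)) := by
  refine _root_.funext (Fin.forall_fin_two.mpr ⟨?_, ?_⟩)
  · rw [translate_zero, pair_zero, pair_zero, fermatGroupEquiv_apply_coe, fermatGroupEquiv_apply_coe]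
    simp
  · rw [translate_one, pair_one, pair_one, fermatGroupEquiv_apply_coe, fermatGroupEquiv_apply_coe]
    simp

/-! ### The roots of `-1` of order `m` -/

/-- The finite set `{u ∈ ℂ | uᵐ = -1}` of slopes of the lines (the roots of `xᵐ + 1`).
[cite: Shioda1979HodgeFermat, §1] -/
def negRoots (m : ℕ) : Finset ℂ :=
  (Polynomial.nthRoots m (-1 : ℂ)).toFinset

/-- `u ∈ negRoots m ↔ uᵐ = -1` (`m ≥ 1`). [folklore] -/
theorem mem_negRoots (hm : 1 ≤ m) {u : ℂ} : u ∈ negRoots m ↔ u ^ m = -1 := by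
  rw [negRoots, Multiset.mem_toFinset, Polynomial.mem_nthRoots hm]

/-- An element of `negRoots m` is a root of `-1`. [folklore] -/
theorem pow_eq_of_mem_negRoots (hm : 1 ≤ m) (u : negRoots m) : (u : ℂ) ^ m = -1 :=
  (mem_negRoots hm).mp u.2

/-- A root of `-1` is non-zero (`m ≥ 1`). [folklore] -/
theorem ne_zero_of_pow_eq_neg_one (hm : 1 ≤ m) {u : ℂ} (hu : u ^ m = -1) : u ≠ 0 := by
  rintro rfl
  rw [zero_pow (by omega)] at hu
  norm_num at hu

/-- **`aᵐ + bᵐ = 0` forces `a = u b` for a root `u` of `-1`** (`m ≥ 1`; if `b = 0` then `a = 0` and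
any root works, e.g. the given `v`). [folklore] -/
theorem exists_eq_negRoot_mul (hm : 1 ≤ m) {v : ℂ} (hv : v ^ m = -1) {a b : ℂ}
    (h : a ^ m + b ^ m = 0) : ∃ u : negRoots m, a = (u : ℂ) * b := by
  by_cases hb : b = 0
  · subst hb
    have ha : a = 0 := pow_eq_zero_iff (n := m) (by omega) |>.mp (by
      simpa [zero_pow (show m ≠ 0 by omega)] using h)
    exact ⟨⟨v, (mem_negRoots hm).mpr hv⟩, by rw [ha, mul_zero]⟩
  · have hu : (a / b) ^ m = -1 := by
      rw [div_pow, div_eq_iff (pow_ne_zero m hb)]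
      linear_combination h
    exact ⟨⟨a / b, (mem_negRoots hm).mpr hu⟩, by rw [div_mul_cancel₀ a hb]⟩

/-! ### Shorthands for the complex orientation family -/

/-- The class `cl L(u, u')` for the complex orientation family, for slopes in `negRoots m`
(reducible shorthand). [cite: Shioda1979HodgeFermat, §1] -/
abbrev lineCls (m : ℕ) [NeZero m] (u u' : negRoots m) : complexBetti (fermatHypersurface (2 * 1) m) (2 * 1) :=
  lineClass complexOrientationFamily m (pair u u') (pair_pow (pow_eq_of_mem_negRoots NeZero.one_le u)
    (pow_eq_of_mem_negRoots NeZero.one_le u')) NeZero.one_le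

/-- Multiplication by a root `u'` of `-1` is a bijection from the `m`-th roots of unity onto the roots
of `-1`. [folklore] -/
def rootsToNegRoots (hm : 1 ≤ m) (u' : negRoots m) : rootsOfUnity m ℂ ≃ negRoots m where
  toFun η := ⟨(u' : ℂ) * ((η : ℂˣ) : ℂ), (mem_negRoots hm).mpr (by
    rw [mul_pow, pow_eq_of_mem_negRoots hm u', ← Units.val_pow_eq_pow_val,
      (mem_rootsOfUnity _ _).mp η.2, Units.val_one, mul_one])⟩
  invFun u'' := ⟨Units.mk0 ((u'' : ℂ) / u') (div_ne_zero
      (ne_zero_of_pow_eq_neg_one hm (pow_eq_of_mem_negRoots hm u''))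
      (ne_zero_of_pow_eq_neg_one hm (pow_eq_of_mem_negRoots hm u'))),
    (mem_rootsOfUnity' _ _).mpr (by
      rw [Units.val_mk0, div_pow, pow_eq_of_mem_negRoots hm u'', pow_eq_of_mem_negRoots hm u', div_self]
      norm_num)⟩
  left_inv η := by
    apply Subtype.ext
    apply Units.ext
    simp [mul_div_cancel_left₀ _ (ne_zero_of_pow_eq_neg_one hm (pow_eq_of_mem_negRoots hm u'))]
  right_inv u'' := by
    apply Subtype.ext
    simp [mul_div_cancel₀ _ (ne_zero_of_pow_eq_neg_one hm (pow_eq_of_mem_negRoots hm u'))]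

/-! ### The reparametrisation of `ℙ¹` -/

/-- The reparametrisation `t_a : [y₀ : y₁] ↦ [a₁⁻¹ y₀ : a₃⁻¹ y₁]` of `ℙ¹`. [folklore] -/
def lineTwist (a : Fin (2 * 1 + 2) → ℂˣ) : Fin (0 + 2) → ℂˣ :=
  ![(a 1)⁻¹, (a 3)⁻¹]

/-! ### The plane families -/

/-- The slopes of the lines of the plane section `x_{2q} = v x_{2q+1}` of `X²ₘ`: slope `v` at the
pair `q`, slope `u` (a root of `-1`) at the other pair. [cite: Shioda1979HodgeFermat, §1] -/
def planeLine (q : Fin 2) (v u : ℂ) : Fin 2 → ℂ :=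
  fun j ↦ if j = q then v else u

/-- The slope at the pair `q` is `v`. [folklore] -/
@[simp] theorem planeLine_self (q : Fin 2) (v u : ℂ) : planeLine q v u q = v := if_pos rfl

/-- The slope at the other pair is `u`. [folklore] -/
theorem planeLine_of_ne {q j : Fin 2} (h : j ≠ q) (v u : ℂ) : planeLine q v u j = u := if_neg h

/-- The slopes of the lines of a plane section are roots of `-1`. [folklore] -/
theorem planeLine_pow (q : Fin 2) {v u : ℂ} (hv : v ^ m = -1) (hu : u ^ m = -1) :
    ∀ j, planeLine q v u j ^ m = -1 := by
  intro j
  by_cases h : j = q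
  · rw [h, planeLine_self]; exact hv
  · rw [planeLine_of_ne h]; exact hu

/-- The homogeneous coordinates of the **apex** of the plane section `x_{2q} = v x_{2q+1}`:
`[v : 1 : 0 : 0]` for `q = 0`, `[0 : 0 : v : 1]` for `q = 1` — the common point of its `m` lines
(for `m = 3` an Eckardt point). [cite: Hartshorne1977, V Ex. 4.16] -/
def apexVec (q : Fin 2) (v : ℂ) : Fin (2 * 1 + 2) → ℂ :=
  ![![v, 1, 0, 0], ![0, 0, v, 1]] q

/-- The apex coordinate vector is non-zero. [folklore] -/
theorem apexVec_ne_zero (q : Fin 2) (v : ℂ) : apexVec q v ≠ 0 := by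
  intro h
  obtain rfl | rfl : q = 0 ∨ q = 1 := by fin_cases q <;> simp
  · have h1 := congr_fun h 1
    simp [apexVec] at h1
  · have h3 := congr_fun h 3
    simp [apexVec] at h3

/-- The parameter `e_q = (1, 0)` resp. `(0, 1)` of the apex on each line of the plane section. [folklore] -/
theorem single_ne_zero (q : Fin 2) : (Pi.single q 1 : Fin (1 + 1) → ℂ) ≠ 0 :=
  Function.ne_iff.mpr ⟨q, by simp⟩

/-! ### The re-embedding `X ↪ ℙ³ ↪ ℙ⁴` of a plane -/

/-- The first coordinate `2q ∈ {0, 2}` of the pair `q`. [folklore] -/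
def pairFst (q : Fin 2) : Fin (3 + 1) := ![0, 2] q

/-- The second coordinate `2q + 1 ∈ {1, 3}` of the pair `q`. [folklore] -/
def pairSnd (q : Fin 2) : Fin (3 + 1) := ![1, 3] q

/-- The linear forms `(x_{2q} - v x_{2q+1}, x₀, x₁, x₂, x₃)` of the re-embedding `ℙ³ ↪ ℙ⁴` under which
the plane `x_{2q} = v x_{2q+1}` becomes the coordinate hyperplane `y₀ = 0`. [cite: Hartshorne1977, II Example 7.1.1] -/
def planeSubst (q : Fin 2) (v : ℂ) : Fin (4 + 1) → MvPolynomial (Fin (3 + 1)) ℂ :=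
  Fin.cons (X (pairFst q) - C v * X (pairSnd q)) X

/-- The forms of `planeSubst` are linear. [folklore] -/
theorem isHomogeneous_planeSubst (q : Fin 2) (v : ℂ) (i : Fin (4 + 1)) :
    (planeSubst q v i).IsHomogeneous 1 := by
  refine Fin.cases ?_ (fun j ↦ ?_) i
  · rw [planeSubst, Fin.cons_zero]
    exact (isHomogeneous_X ℂ _).sub (isHomogeneous_C_mul_X v _)
  · rw [planeSubst, Fin.cons_succ]
    exact isHomogeneous_X ℂ j

/-- Every variable of `ℙ³` is hit by `planeSubst`. [folklore] -/
theorem exists_planeSubst_eq_X (q : Fin 2) (v : ℂ) (j : Fin (3 + 1)) : ∃ i, planeSubst q v i = X j :=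
  ⟨j.succ, by rw [planeSubst, Fin.cons_succ]⟩

/-- The value of the new coordinate `y₀` at `z`: `z_{2q} - v z_{2q+1}`. [folklore] -/
theorem aeval_planeSubst_zero (q : Fin 2) (v : ℂ) (z : Fin (3 + 1) → ℂ) :
    aeval z (planeSubst q v 0) = z (pairFst q) - v * z (pairSnd q) := by
  rw [planeSubst, Fin.cons_zero, map_sub, map_mul, aeval_C, aeval_X, aeval_X,
    Algebra.algebraMap_self, RingHom.id_apply]

/-- The re-embedding `X²ₘ ↪ ℙ³ ↪ ℙ⁴` attached to the plane `x_{2q} = v x_{2q+1}`.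
[cite: Hartshorne1977, II Example 7.1.1] -/
def planeEmb (m : ℕ) (q : Fin 2) (v : ℂ) : (fermatHypersurface (2 * 1) m) ⟶ Motives.projectiveSpace 4 ℂ :=
  (SmoothHypersurface.hypersurfaceι (fermatPolynomial ℂ (2 * 1) m)) ≫ ProjectiveSpace.linSubstMap (planeSubst q v) (isHomogeneous_planeSubst q v)
    (exists_planeSubst_eq_X q v)

/-- `X²ₘ ↪ ℙ⁴` is a closed immersion. [cite: Hartshorne1977, II Ex. 3.12] -/
theorem isClosedImmersion_planeEmb_left (m : ℕ) (q : Fin 2) (v : ℂ) :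
    IsClosedImmersion (planeEmb m q v).left := by
  rw [planeEmb, Over.comp_left]
  haveI := ProjectiveSpace.isClosedImmersion_linSubstMap_left (planeSubst q v)
    (isHomogeneous_planeSubst q v) (exists_planeSubst_eq_X q v)
  infer_instance

end FermatSurface

end Literature.AlgebraicGeometry.HodgeTheory

end
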